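import Summits.BirchSwinnertonDyer.Rank1Residual.Additive.PotSupersingularTargets
import Literature.NumberTheory.EllipticCurves.Kato2004.Condition1252
import Literature.NumberTheory.EllipticCurves.Kato2004.AdditivePotGoodRankZeroShaUpperBound
import HarnessLib

/-!
# O6 targets (WILD `p = 3`, `v₃(N) ∈ {3,4,5}`) — T-O6-A over the interface `KMC`, the DFV wild-type
# sub-partition interface, T-O6-B's assembly shell and the pre-registered census falsifiers
# (cell `b2b-bsdres`, lane CLASS-CLOSURE, team o6; content = planner o6-r1 (Iwasawa side),
# placement + dedup + kernel glue = cc-typer-5) — TYPED, NOTHING ASSERTED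

HONEST FRAMING (cell `b2b-bsdres`, run/shared/lean/b2b/bsd-rank1-residual/, verbatim in every
file): the goal of the cell is to DELETE the COMBINATION-SHAPED residual classes of the
Birch–Swinnerton-Dyer formula for ALL analytic-rank `≤ 1` elliptic curves over `ℚ` — "full BSD
formula for every rank `≤ 1` curve in class `C`" assembled STRICTLY from published theorems — so
that the rank-`≤ 1` remainder becomes exactly the CONSTRUCTION-SHAPED classes, which are TYPED
(missing-input `Prop`s), NOT attempted. This is not "finishing BSD". Lane CLASS-CLOSURE
(`CLASS-CLOSURE-PLAN.md` §3.4 O6): research routes; no claim beyond the stated classes; census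
output is EVIDENCE / conjecture items, never a Literature fact; no Literature fact is minted here,
no `_holds`, no main conjecture inside any certificate; nothing is booked and no mark of
`RESIDUAL-MAP.md` moves.

Source: planner o6-r1's typed sketch `HOME/b2b-bsdres-o6-r1/O6Targets.lean` (sha256
`32c5932538716c2c…`, farm rc 0; long form `O6-IWASAWA-PLAN.md`; convergence file
`HOME/cells/o5o6/TARGETS.md` §O6, sha16 `12688f0362ad85a1`: CONVERGED slot 1 = **T-O6-A** "KMC₃ +
additive descent" (EVIDENCE-shaped conjecture, PRINTED antecedent Kato, Astérisque 295, Conj. 12.10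
p. 224 — no reduction-type hypothesis), slot 2 = T-O6-C (o6-r2, `Additive/WildThreeRefinedKolyvagin.lean`
+ `O5/HeegnerIndexThree.lean`); T-O6-B "conductor-9 signed pair" = OBJECT-CANDIDATE, kept as o6-r1's
seat note and typed here only as its ASSEMBLY shell). Every new object the targets need is an
INTERFACE PARAMETER (definition requests D-O6-1 wild type, D-O6-2 `Kato2004.MainConjecture W p`,
D-O6-3 signed objects, D-O6-4 Mazur–Tate `λ/μ`), never smuggled in; every `@[conjecture] def` is a
SHELL. TYPER EDITS (cc-typer-5, OWNERS §0 items 6–7): (1) the planner's `O6Sharp := X3SharpW ∧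
X4SharpW` is NOT re-declared — the class statement of record is gen 0's `Additive.O6Sharp`
(`Additive/PotSupersingularTargets.lean`), and the decomposition is PROVED
(`o6Sharp_iff_x3SharpW_and_x4SharpW`); (2) the planner's `missingPPartAt_of_halves` is the tree's
`Typed.missingPPartAt_of_lower_of_upper` and is not re-declared; (3) the wild-type interface
`AdmissibleWildTyping` is stated against the tree's predicates BY NAME (`Addv`, `SubW`, `condExp`,
`krausInertiaOrderThree`) and additionally pins the Kraus inertia order of each type, so that the
E2 dictionary "abelian/unramified-dihedral types = `SubWCyclic`, ramified-dihedral types =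
`SubWDicyclic`" is a KERNEL consequence (`inertiaOrder_eq_twelve_iff_subWDicyclic`,
`condExp_eq_four_iff_subWCyclic`); (4) kernel assembly `missingPPartAt_three_of_lowerHalfOfKMC_of_kato`
(T-O6-A lower half + Kato's upper half ⇒ the `3`-part on `X4 ∧ (w) ∧ r0 ∧ (12.5.2)`); the shared
O5 ∪ O6 descent shell itself is `O5/O5Targets.lean` `O5.PotSupersingularLowerHalfRankZeroOfKMC`
(its `ClassX4 ∧ SubW` restriction is `LowerHalfRankZeroOfKMC` below; bridge filed once both land).

EVIDENCE of record for the sub-partition (instrumentation, two engines, `class-closure/O6/census-typer5/SUMMARY.md`,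
kit j120833 + stdlib engine B on all 79 420 wild S-b pairs of `sweep/v4f/RESIDUE.jsonl` sha256
`94a3b5a5…`): `v₃(N) = 4 ⟺` Kraus order `∈ {3, 6}` (`8 630 + 8 352 = 16 982` pairs),
`v₃(N) ∈ {3, 5} ⟺` Kraus order `12` (`54 951 + 7 487 = 62 438`), `0` exceptions — Dembélé–Freitas–Voight,
arXiv:2203.07787 Prop. 5.2.2 (p. 16, read): additive potentially good at `3` with `e ≥ 3`:
`N_E = 3³ ⇒ e = 12`, `τ = sc(±3,2,6)`; `N_E = 3⁴ ⇒ e ∈ {3,6}`, `τ` principal series `ps(1,2,3)(⊗ε₃)`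
or supercuspidal unramified `sc(−1,2,3)(⊗ε₃)`; `N_E = 3⁵ ⇒ e = 12`, `τ = sc(−3,4,6)_j`.
-/

noncomputable section

open scoped Classical

open WeierstrassCurve Literature.NumberTheory.EllipticCurves
  Literature.NumberTheory.EllipticCurves.ModularForms
  Literature.NumberTheory.EllipticCurves.Rank1Residual
  Literature.NumberTheory.EllipticCurves.Rank1Residual.Typed
  Summit.BirchSwinnertonDyer.Rank1Residual.Additive

namespace Summit.BirchSwinnertonDyer.Rank1Residual.O6

/-! ## §0 The class shell on the X4 side, and the decomposition of gen 0's `O6Sharp` -/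

/-- **X4♯(w)**: X4♯ on the census cell (w) = wild `p = 3` (60 568 S-b pairs: r0 55 220 / r1 5 348);
sibling of the hyp seat's `X3SharpW` (`Additive/SharpenedStatements.lean`). OPEN; nothing asserted.
[folklore] -/
@[conjecture] def X4SharpW : Prop :=
  ∀ (W : WeierstrassCurve ℚ) [W.IsElliptic] [W.IsGloballyMinimal] (p : ℕ) [Fact p.Prime],
    W.analyticRank ≤ 1 → ClassX4 W p → SubW W p → MissingPPartAt W p

/-- **O6♯ = X3♯(w) ∧ X4♯(w)** — the class statement of record `Additive.O6Sharp` (gen 0) is exactly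
the conjunction of its X3 and X4 halves (`ClassO6 W p = p ≠ 2 ∧ Addv W p ∧ SubW W p`; an odd
additive pair is X3 or X4, `classX3_or_classX4_iff_addv`). Replaces the planner's re-declaration
of `O6Sharp`; no pair lost, none doubled. [folklore] -/
theorem o6Sharp_iff_x3SharpW_and_x4SharpW : O6Sharp ↔ X3SharpW ∧ X4SharpW := by
  constructor
  · intro h
    exact ⟨x3SharpW_of_o6Sharp h, fun W _ _ p _ hr hX hW ↦ h W p hr ⟨hX.1, hX.2.1, hW⟩⟩
  · rintro ⟨h3, h4⟩ W _ _ p _ hr hO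
    rcases (classX3_or_classX4_iff_addv W p hO.1).mpr hO.2.1 with hX | hX
    · exact h3 W p hr hO.1 hX hO.2.2
    · exact h4 W p hr hX hO.2.2

/-! ## §1 E2 sub-partition interface: the wild inertial type at `3` (Dembélé–Freitas–Voight 2022, Prop. 5.2.2)

D-O6-1 (definition request): `wildTypeAt3 W` for a curve with `SubW W 3`, DECIDABLE from a model
(`v₃(N) ∈ {3,5} ⇒` ramified dihedral; at `v₃(N) = 4`: good reduction over `ℚ₃(μ₉) ⇔` abelian). Here:
an interface, pinned to the tree's Kraus cells (`Additive/WildThreeKrausCells.lean`). -/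

/-- The six wild inertial type classes at `3` (DFV Table 3 / Prop. 5.2.2: `ab3/ab6` = principal series
`ps(1,2,3)(⊗ε₃)`, `e = 3/6` — ABELIAN, good over `ℚ₃(μ₉)`; `du3/du6` = supercuspidal induced from the
UNRAMIFIED quadratic field, `sc(−1,2,3)(⊗ε₃)`, `e = 3/6`; `dr3/dr5` = supercuspidal induced from a
RAMIFIED quadratic field, `e = 12`, at `v₃(N) = 3` (`sc(±3,2,6)`, two types) / `v₃(N) = 5`
(`sc(−3,4,6)_j`, three types)). [cite: DembeleFreitasVoight2022, Prop. 5.2.2 and Table 3 (p. 16)] -/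
inductive WildType | ab3 | ab6 | du3 | du6 | dr3 | dr5
  deriving DecidableEq, Repr

/-- The abelian (trianguline, "conductor-9 twist has finite slope") types — T-O6-B's locus.
[cite: DembeleFreitasVoight2022, Prop. 5.2.2 (c) (p. 16)] -/
def WildType.IsAbelian : WildType → Bool
  | .ab3 => true | .ab6 => true | _ => false

/-- The conductor exponent each type forces (DFV Prop. 5.2.2: `v₃(N) = 4` except the `e = 12` types,
`v₃(N) = 3` resp. `5`). [cite: DembeleFreitasVoight2022, Prop. 5.2.2 (p. 16)] -/
def WildType.condExp : WildType → ℕ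
  | .dr3 => 3 | .dr5 => 5 | _ => 4

/-- The semistability defect `e = #Φ` each type forces (DFV Prop. 5.2.2: `e = 3` for `ab3/du3`, `6` for
`ab6/du6`, `12` for the ramified dihedral types) — the tree's `krausInertiaOrderThree` on those rows
(Kraus's `p = 3` table). [cite: DembeleFreitasVoight2022, Prop. 5.2.2 (p. 16)] [cite: Kraus1990, Théorème (p = 3)] -/
def WildType.inertiaOrder : WildType → ℕ
  | .ab3 => 3 | .du3 => 3 | .ab6 => 6 | .du6 => 6 | .dr3 => 12 | .dr5 => 12

/-- Per type: conductor exponent `4` iff the inertia is not the dicyclic group of order `12`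
(finite check). [cite: DembeleFreitasVoight2022, Prop. 5.2.2 (p. 16)] -/
theorem WildType.condExp_eq_four_iff (t : WildType) : t.condExp = 4 ↔ t.inertiaOrder ≠ 12 := by
  cases t <;> decide

/-- Per type: an abelian type has cyclic inertia of order `3` or `6` (finite check).
[cite: DembeleFreitasVoight2022, Prop. 5.2.2 (c) (p. 16)] -/
theorem WildType.inertiaOrder_ne_twelve_of_isAbelian (t : WildType) (h : t.IsAbelian = true) :
    t.inertiaOrder ≠ 12 := by
  cases t <;> simp_all [WildType.IsAbelian, WildType.inertiaOrder]

/-- INTERFACE for D-O6-1: a wild-type assignment `τ` is *admissible* when, on every wild additive pair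
at `3` (`Addv W 3 ∧ SubW W 3`, tree predicates), it respects the conductor exponent (`condExp W 3`,
`SharpenedStatements.lean`) AND Kraus's inertia order (`krausInertiaOrderThree W`,
`WildThreeKrausCells.lean`) that DFV Prop. 5.2.2 attaches to the type. (The real definition — via the
Néron model over `ℚ₃(μ₉)` or DFV's norm-group test — replaces this parameter and satisfies both
clauses by DFV Prop. 5.2.2 + Kraus; the targets below are stated over ANY admissible assignment.
TYPER edit: the planner's interface carried the conductor clause only.) Nothing asserted.
[cite: DembeleFreitasVoight2022, Prop. 5.2.2 (p. 16)] [cite: Kraus1990, Théorème (p = 3)] -/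
def AdmissibleWildTyping
    (τ : ∀ (W : WeierstrassCurve ℚ) [W.IsElliptic] [W.IsGloballyMinimal], WildType) : Prop :=
  ∀ (W : WeierstrassCurve ℚ) [W.IsElliptic] [W.IsGloballyMinimal],
    Addv W 3 → SubW W 3 →
      condExp W 3 = (τ W).condExp ∧ krausInertiaOrderThree W = (τ W).inertiaOrder

section WildTypeDictionary

variable {τ : ∀ (W : WeierstrassCurve ℚ) [W.IsElliptic] [W.IsGloballyMinimal], WildType}

/-- **The E2 dictionary, kernel form: ramified-dihedral type ⟺ the dicyclic Kraus cell.** For an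
admissible typing and a wild pair whose Kodaira symbol at `3` is one of the wild types `II, IV, IV*,
II*` (Kraus; hypothesis, as in `krausInertiaOrderThree_of_wildType`): `(τ W).inertiaOrder = 12 ↔
SubWDicyclic W` (`v₃(Δ_min)` odd). CENSUS (EVIDENCE, census-typer5 two-engine on 79 420 wild S-b
pairs): `v₃(N) ∈ {3,5}` on exactly the `62 438` dicyclic rows.
[cite: Kraus1990, Théorème (p = 3)] [cite: DembeleFreitasVoight2022, Prop. 5.2.2 (b), (d) (p. 16)] -/
theorem inertiaOrder_eq_twelve_iff_subWDicyclic (hτ : AdmissibleWildTyping τ)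
    (W : WeierstrassCurve ℚ) [W.IsElliptic] [W.IsGloballyMinimal] (hadd : Addv W 3) (hW : SubW W 3)
    (hk : W.kodairaSymbolAt (placeOf 3) = .II ∨ W.kodairaSymbolAt (placeOf 3) = .IV ∨
      W.kodairaSymbolAt (placeOf 3) = .IVstar ∨ W.kodairaSymbolAt (placeOf 3) = .IIstar) :
    (τ W).inertiaOrder = 12 ↔ SubWDicyclic W := by
  obtain ⟨_, hko⟩ := hτ W hadd hW
  obtain ⟨heven, hodd⟩ := krausInertiaOrderThree_of_wildType W hk
  constructor
  · intro h12
    refine ⟨hW, ?_⟩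
    rcases Nat.even_or_odd (padicValInt 3 W.minimalDiscriminantInt) with he | ho
    · exfalso
      rcases heven he with h3 | h6
      · rw [hko, h12] at h3; exact absurd h3 (by decide)
      · rw [hko, h12] at h6; exact absurd h6 (by decide)
    · exact ho
  · rintro ⟨_, ho⟩
    rw [← hko]
    exact hodd ho

/-- **The E2 dictionary, kernel form: conductor exponent `4` ⟺ the cyclic Kraus cell** (abelian and
unramified-dihedral types together; `v₃(Δ_min)` even). CENSUS (EVIDENCE, census-typer5): `v₃(N) = 4`
on exactly the `16 982` cyclic rows (`C₃` 8 630, `C₆` 8 352).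
[cite: Kraus1990, Théorème (p = 3)] [cite: DembeleFreitasVoight2022, Prop. 5.2.2 (c) (p. 16)] -/
theorem condExp_eq_four_iff_subWCyclic (hτ : AdmissibleWildTyping τ)
    (W : WeierstrassCurve ℚ) [W.IsElliptic] [W.IsGloballyMinimal] (hadd : Addv W 3) (hW : SubW W 3)
    (hk : W.kodairaSymbolAt (placeOf 3) = .II ∨ W.kodairaSymbolAt (placeOf 3) = .IV ∨
      W.kodairaSymbolAt (placeOf 3) = .IVstar ∨ W.kodairaSymbolAt (placeOf 3) = .IIstar) :
    condExp W 3 = 4 ↔ SubWCyclic W := by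
  obtain ⟨hc, _⟩ := hτ W hadd hW
  rw [hc, WildType.condExp_eq_four_iff, Ne, inertiaOrder_eq_twelve_iff_subWDicyclic hτ W hadd hW hk]
  constructor
  · intro hnd
    rcases (subW_three_iff_cyclic_or_dicyclic W).mp hW with h | h
    · exact h
    · exact absurd h hnd
  · exact fun hcyc ↦ subWCyclic_disjoint_dicyclic W hcyc

/-- **T-O6-B's locus lies in the cyclic cell**: an abelian type (`ab3/ab6`: principal series, good
supersingular over the abelian field `ℚ₃(μ₉)` — the (G₉) rows) has `v₃(Δ_min)` even.
[cite: DembeleFreitasVoight2022, Prop. 5.2.2 (c) (p. 16)] [cite: Kraus1990, Théorème (p = 3)] -/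
theorem subWCyclic_of_isAbelian (hτ : AdmissibleWildTyping τ)
    (W : WeierstrassCurve ℚ) [W.IsElliptic] [W.IsGloballyMinimal] (hadd : Addv W 3) (hW : SubW W 3)
    (hk : W.kodairaSymbolAt (placeOf 3) = .II ∨ W.kodairaSymbolAt (placeOf 3) = .IV ∨
      W.kodairaSymbolAt (placeOf 3) = .IVstar ∨ W.kodairaSymbolAt (placeOf 3) = .IIstar)
    (hab : (τ W).IsAbelian = true) : SubWCyclic W := by
  rcases (subW_three_iff_cyclic_or_dicyclic W).mp hW with h | h
  · exact h
  · exact absurd ((inertiaOrder_eq_twelve_iff_subWDicyclic hτ W hadd hW hk).mpr h)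
      ((τ W).inertiaOrder_ne_twelve_of_isAbelian hab)

end WildTypeDictionary

/-! ## §2 T-O6-A — Kato's main conjecture 12.10 at `(f_E, 3)` + additive descent (type-agnostic)

D-O6-2 (definition request): the STATEMENT `Kato2004.MainConjecture W p : Prop` = Conj. 12.10 for
`T = T_pE(−1)` ("for every height-one `𝔭` of `Λ = ℤ_p⟦Gal(ℚ(ζ_{p^∞})/ℚ)⟧`: `Z(f,T)_𝔭 ⊂ 𝐇¹(T)_𝔭` and
`length 𝐇²(T)_𝔭 = length (𝐇¹(T)/Z(f,T))_𝔭`") — a conjecture (human ruling: conjectures live in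
`Summits/`), NOT yet definable over the tree's vocabulary (it needs the global Iwasawa cohomology
`𝐇ⁱ(T) = lim H^i(ℤ[ζ_{pⁿ}, 1/p], T)` and the zeta submodule as objects; recorded in
`class-closure/O6/TYPED.md` as the open definition item). Interface here: `KMC`. -/

section TO6A

variable (KMC : ∀ (W : WeierstrassCurve ℚ) [W.IsElliptic] [W.IsGloballyMinimal] (p : ℕ), Prop)

/-- **T-O6-A (A0, rank 0, big image): KMC₃ ⇒ the LOWER half** `ord₃ #Ш_an ≤ ord₃ #Ш` on every wild
X4 pair with Kato's (12.5.2). Printed antecedent: Kato Conj. 12.10 (p. 224) + Prop. 14.16 (2) (p. 244)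
read as an EQUALITY + the additive local index `exp* H¹(ℚ₃,T) = c₃·3^{−t}ℤ₃` (Kim 2026 §3.2.3 display;
no condition on c₃) + the ℓ ≠ 3 Tamagawa equality (Kim 2025 Conj. 7.4, additive case). The UPPER half
is the tree's `Kato2004.rankZero_padicValNat_sha_le_sub_localTamagawa_…` (in print). The
`ClassX4 ∧ SubW` restriction of the shared O5 ∪ O6 shell `O5.PotSupersingularLowerHalfRankZeroOfKMC`
(`O5/O5Targets.lean`, same interface `KMC`). EVIDENCE-shaped conjecture shell; nothing asserted. -/
@[conjecture] def LowerHalfRankZeroOfKMC : Prop :=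
  ∀ (W : WeierstrassCurve ℚ) [W.IsElliptic] [W.IsGloballyMinimal],
    W.analyticRank = 0 → ClassX4 W 3 → SubW W 3 → Kato2004.ImageContainsSL2 W 3 →
    KMC W 3 → MissingLowerBoundAt W 3

/-- **T-O6-A (A0♭, rank 0, the X3-wild = reducible-mod-3 rows):** KMC₃ for SOME curve in the
3-isogeny class (the μ = 0 member) ⇒ the full 3-part for W (Cassels transport inside the class is in
the kernel). Interface: `isog W W'` = "3-power isogenous over ℚ" (tree notion: `AdditivePotMult`'s
isogeny-invariance files state it per explicit isogeny; kept abstract here). Conjecture shell;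
nothing asserted. -/
@[conjecture] def X3WildOfKMC (isog : WeierstrassCurve ℚ → WeierstrassCurve ℚ → Prop) : Prop :=
  ∀ (W : WeierstrassCurve ℚ) [W.IsElliptic] [W.IsGloballyMinimal],
    W.analyticRank ≤ 1 → ClassX3 W 3 → SubW W 3 →
    (∃ (W' : WeierstrassCurve ℚ) (_ : W'.IsElliptic) (_ : W'.IsGloballyMinimal), isog W W' ∧ KMC W' 3) →
    MissingPPartAt W 3

/-- **T-O6-A (A1, rank 1): KMC₃ ∧ the additive-3 Perrin-Riou 'Kato point' formula (sub-conjecture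
T-O6-A1′, interface `PRKato`) ∧ non-degenerate 3-adic height (interface `HtNondeg`) ⇒ the 3-part.**
(Dead ends recorded by the planner, `O6-IWASAWA-PLAN.md` §7: Kitajima–Otsuki ± needs E good at an
unramified base; Kim 2025 Cor 1.10 needs `p² ∤ N`, so no Kurihara route on wild rank 1.)
STATUS OF THE INTERFACES (cell `bsd-potss`, seat `kmc`, 2026-08-25; docstring record only, nothing
asserted): T-O6-A1′ is a conjecture IN PRINT — the `r = 1` case of Burns–Kurihara–Sano's
"Generalized Perrin-Riou Conjecture" Conj. 1.5 (at `r = 1`: `z_ℚ = (L_S′(E,1)/(Ω⁺·R_∞))·log_ω(x)·x`,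
"equivalent to Perrin-Riou's conjecture", Remark 1.7 (i) and the display after it; their Bockstein
regulator `R_ω^{Boc}` "can be defined even in the case that E has additive reduction at p", §1.3.1),
with their Thm. 7.3 (the Iwasawa Main Conjecture ⇒ Conj. (mrs3) "up to `ℤ_p^×`", under Hyp. 2.2)
and Thm. 7.6 (IMC + Conj. 1.5 + `R_ω^{Boc} ≠ 0` ⇒ the `p`-part of the BSD formula), "even in the case
of additive reduction" (Remark 7.7) — realised in the tree as the
NAMED node `Additive.PerrinRiouUpToUnitAt PRRatio W p` over the interface `PRRatio`
(`Additive/KatoDescentRankOnePerrinRiou.lean`) next to the printed-shape count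
`Additive.RankOneCountReading`; the kernel descent `Additive.rankOne_missingPPartAt_of_kmc_of_readings`
(`Additive/KMCTrivialDescentRankOne.lean`) gives `KMC W 3 ⇒ MissingPPartAt W 3` in analytic rank
one over those readings WITHOUT a height hypothesis (`HtNondeg` is idle on that road). This shell is
kept as typed; its re-gluing through `PerrinRiouUpToUnitAt` is the `kmc` seat's.
Conjecture shell over three interfaces; nothing asserted.
[cite: BurnsKuriharaSano2019, Conj. 1.5, Remark 1.7 (i), §1.3.1, Thm. 7.3, Thm. 7.6 and Remark 7.7]
[cite: Kato2004Asterisque, Conj. 12.10 (p. 224), §14.14 (p. 243)] -/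
@[conjecture] def RankOneOfKMC (PRKato HtNondeg : ∀ (W : WeierstrassCurve ℚ) [W.IsElliptic] [W.IsGloballyMinimal], Prop) :
    Prop :=
  ∀ (W : WeierstrassCurve ℚ) [W.IsElliptic] [W.IsGloballyMinimal],
    W.analyticRank = 1 → (ClassX3 W 3 ∨ ClassX4 W 3) → SubW W 3 →
    KMC W 3 → PRKato W → HtNondeg W → MissingPPartAt W 3

/-- **T-O6-A (A0) composes to the class output on `X4 ∧ (w) ∧ r0 ∧ (12.5.2)`** (kernel bookkeeping
over PUBLISHED facts as explicit hypotheses — Kato Thm. 14.5 (3) `hKato`, Gross–Zagier–Kolyvagin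
`hGZK`, modularity `hmod` — and the interface): the lower half from `KMC W 3`, the upper half from
Kato (gen 0's `ClassO6.missingPPartAt_iff_lower_of_kato`), on the rows with `3 ∤ ∏ c_ℓ` and a
parametrisation datum with `3 ∤ c_D`. Nothing is credited: `KMC` is a hypothesis.
[cite: Kato2004Asterisque, Thm. 14.5 (3) (p. 236), (12.5.2) (p. 222)] [cite: Miller2011LMS, Def. 1.1] -/
theorem missingPPartAt_three_of_lowerHalfOfKMC_of_kato (hlow : LowerHalfRankZeroOfKMC KMC)
    (hKato : Kato2004.rankZero_padicValNat_sha_le_of_additive_potGood_of_imageContainsSL2)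
    (hGZK : rank_eq_analyticRank_of_analyticRank_le_one) (hmod : hasEntireLFunction_rat)
    (W : WeierstrassCurve ℚ) [W.IsElliptic] [W.IsGloballyMinimal]
    (hr : W.analyticRank = 0) (hX : ClassX4 W 3) (hW : SubW W 3)
    (hsurj : ∀ n : ℕ, W.HasSurjectiveModNGaloisRep (3 ^ n : ℕ)) (htam : ¬ 3 ∣ W.tamagawaProduct)
    {N : ℕ} [NeZero N] (D : ModularParametrizationData W N) (hc : ¬ (3 : ℤ) ∣ D.maninConstant)
    (hKMC : KMC W 3) : MissingPPartAt W 3 := by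
  have hO : ClassO6 W 3 := ⟨hX.1, hX.2.1, hW⟩
  have himg : Kato2004.ImageContainsSL2 W 3 :=
    (Kato2004.imageContainsSL2_iff_forall_hasSurjectiveModNGaloisRep W 3).mpr hsurj
  exact (ClassO6.missingPPartAt_iff_lower_of_kato W 3 hKato hGZK hmod hr hO hX hsurj htam D
    (by exact_mod_cast hc)).mpr (hlow W hr hX hW himg hKMC)

end TO6A

/-! ## §3 T-O6-B — the conductor-9 signed pair on the ABELIAN types (OBJECT-CANDIDATE; seat note of o6-r1)

D-O6-3 (definition request): the signed objects `L₃^♯(W), L₃^♭(W) ∈ Λ ⊗ ℚ` and `Sel^{♯/♭}(W/ℚ_∞)` for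
`(τ W).IsAbelian` (via f̃ = newform of f_E ⊗ ε̄, ε of conductor 9; Kato Thm. 16.2/16.6 for f̃; a
type-determined half-logarithm matrix M_τ; Delbourgo 1998 p. 152 forecast). Until they exist the only
TYPEABLE content is (i) the assembly shell over an interface and (ii) its census-facing falsifier (§4). -/

section TO6B

variable (τ : ∀ (W : WeierstrassCurve ℚ) [W.IsElliptic] [W.IsGloballyMinimal], WildType)
variable (SignedMC : ∀ (W : WeierstrassCurve ℚ) [W.IsElliptic] [W.IsGloballyMinimal], Prop)
variable (KMC : ∀ (W : WeierstrassCurve ℚ) [W.IsElliptic] [W.IsGloballyMinimal] (p : ℕ), Prop)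

/-- **T-O6-B (B4 ⇒ KMC): on the abelian wild types the signed main conjecture (interface) implies
Kato's 12.10** — the assembly statement that makes T-O6-B feed T-O6-A (model case in print: Kobayashi
2003 Thm. 7.4, `±` MC ⟺ Kato's MC at a good supersingular prime). OBJECT-CANDIDATE shell over three
interfaces; nothing asserted. -/
@[conjecture] def SignedMCGivesKMC : Prop :=
  ∀ (W : WeierstrassCurve ℚ) [W.IsElliptic] [W.IsGloballyMinimal],
    SubW W 3 → (τ W).IsAbelian = true → SignedMC W → KMC W 3

end TO6B

/-! ## §4 The census-facing falsifiers (pre-registered P1–P3; E1 = Mazur–Tate Iwasawa-invariant census)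

D-O6-4 (definition request, census currency): `mtLambda W n` = λ-invariant of the Mazur–Tate element
θ_n(E) ∈ ℤ₃[Gal(k_n/ℚ)] (k_n the n-th layer of the cyclotomic ℤ₃-extension), `mtMu W n` its μ (the
tree has Mazur–Tate elements for the supersingular classes, `Supersingular/MazurTate*.lean`; the
additive-level instrument is ttrl2's / ENG-D). PRE-REGISTRATION of record: `CLASS-CLOSURE-PLAN.md`
§3.4 E1 (o6-r1 block ⟦05:01Z⟧, P1–P4 + held-out); a shell below becomes an EVIDENCE item only with
the census report sha in its docstring (to be appended by the class typer when ttrl2 w4 reports). -/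

section Census

variable (τ : ∀ (W : WeierstrassCurve ℚ) [W.IsElliptic] [W.IsGloballyMinimal], WildType)
variable (mtLambda mtMu : ∀ (W : WeierstrassCurve ℚ) [W.IsElliptic] [W.IsGloballyMinimal], ℕ → ℕ)

/-- Second difference in `n` of a sequence (the growth-shape statistic of P2). [folklore] -/
def secondDiff (a : ℕ → ℕ) (n : ℕ) : ℤ := (a (n + 2) : ℤ) - 2 * (a (n + 1) : ℤ) + (a n : ℤ)

/-- **P1 (pre-registered): μ(θ_n) = 0 for n ≥ 2 on every wild X4 pair.** Falsifier shell over the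
interface `mtMu`; EVIDENCE item once the census report exists; nothing asserted. [folklore] -/
@[conjecture] def MuZeroOnX4Wild : Prop :=
  ∀ (W : WeierstrassCurve ℚ) [W.IsElliptic] [W.IsGloballyMinimal],
    ClassX4 W 3 → SubW W 3 → ∀ n, 2 ≤ n → mtMu W n = 0

/-- **P2 (pre-registered falsifier of T-O6-B (B2)): on the ABELIAN wild types the growth shape of
λ(θ_n(E)) depends only on the type** — two curves of the same abelian type have identical second
differences of `n ↦ λ(θ_n)` from `n = 2` on (Kobayashi–Pollack alternating shape, type-determined q_n;
Lei–Palvannan–Pratap arXiv:2412.16629 Thm 4.5 is the `e = 2` precedent, §4.3 / Example 4.8 the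
non-alternating tame (t′) shape). If the census shows this failing on held-out rows, (B2)
"type-determined half-logarithm matrix" is dead as stated. Shell over `τ`, `mtLambda`; nothing asserted.
[folklore] -/
@[conjecture] def LambdaTypeLawAbelian : Prop :=
  ∀ (W : WeierstrassCurve ℚ) [W.IsElliptic] [W.IsGloballyMinimal]
    (W' : WeierstrassCurve ℚ) [W'.IsElliptic] [W'.IsGloballyMinimal],
    SubW W 3 → SubW W' 3 → τ W = τ W' → (τ W).IsAbelian = true →
    ∀ n, 2 ≤ n → secondDiff (mtLambda W) n = secondDiff (mtLambda W') n

/-- **P3 (pre-registered, rank 0, tower-surjective rows): the bounded part of λ vanishes exactly on the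
unit rows** — stated with the LPP lower bound λ(θ_n) ≥ 3^{n−1} (arXiv:2412.16629 Lemma 5.1) as
"λ(θ_n) = 3^{n−1} + (type term) for all n ≥ 2 ⇔ 3 ∤ #Ш_an·∏c", the type term being an interface
`typeTerm τ n` (on `r_an = 0 ∧ 3 ∤ #Ш_an` rows `#Ш = #Ш_an` at `3` is the kernel's unit closure, so
`W.shaOrder` is the census's `#Ш_an` there). Shell; nothing asserted. [folklore] -/
@[conjecture] def UnitRowsLaw (typeTerm : WildType → ℕ → ℕ) : Prop :=
  ∀ (W : WeierstrassCurve ℚ) [W.IsElliptic] [W.IsGloballyMinimal],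
    W.analyticRank = 0 → ClassX4 W 3 → SubW W 3 → Kato2004.ImageContainsSL2 W 3 →
    ((∀ n, 2 ≤ n → mtLambda W n = 3 ^ (n - 1) + typeTerm (τ W) n) ↔
      ¬ 3 ∣ W.shaOrder * W.tamagawaProduct)

end Census

end Summit.BirchSwinnertonDyer.Rank1Residual.O6

end
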